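import Summits.ValiantsHypothesis.ValiantsHypothesis.Theorems.BarrierLeverAnchoredDoorHitsLowerPairsSplitGeneralDesignTop
import Summits.ValiantsHypothesis.ValiantsHypothesis.Theorems.BarrierLeverAnchoredDoorHitsLowerPairsSplitGeneralZeon
import Summits.ValiantsHypothesis.ValiantsHypothesis.Theorems.BarrierLeverAnchoredDoorHitsLowerPairsSplitGeneralCore

/-!
# Support item `AnchoredDoorHitsLowerPairs` (stmt-ValiantsHypothesis-22510), line `anchored-peeling`:
# CONJECTURE SP for all `m` — part 5: ROW COORDINATES AND THE COLUMN TOPS OF THE LIMIT DESIGN AT EVERY ROW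

Helper file (`--supports stmt-ValiantsHypothesis-22510`; cell valiant-natproofs, rung V4, 𝒟-side door (c); registered line
`Cruxes/AnchoredDoorHitsLowerPairs/Lines/anchored_peeling.lean` v24, registered stub `stub_splitFamilyGe3`; prover seat val-np-p1 gen 24;
memo HOME/val-np-p1/g24/MEMO-SP-proof-valnp1-g24.md §2.2, §6 B3). Closes NO item.

WHAT. Rows of the split pair by value are `rowC m S e T = S ∪ [e]{α} ∪ sh m T` (`S ⊆ range (m+1)` the `a`-part, `e` the `α`-bit, `T ⊆ range m` the `b`-index set);
`rowC` is injective with componentwise unions / disjointness (`rowC_inj`, `rowC_union`, `disjoint_rowC_iff`). The limit design of `…SplitGeneralDesignTop` is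
rewritten in these coordinates: the clique vertex `v_P` is `persona [C = rowC P false ∅]` plus an `α`-part with coefficient function `aco m P S T`
(`vtopN_clique_rowC`), the independent vertex `u_t` is `[C = rowC ∅ false t]` (`vtopN_indep_rowC`), and the convolutions giving the EDGE columns are evaluated
at every row (`conv_vv_rowC`, `conv_vu_rowC`): persona ⋆ persona, persona ⋆ α-part (`[P ⊆ S] · aco P' (S ∖ P) T`), α ⋆ α = 0. Finally `aco_sum`: the sum
`Σ_{P'} γ P' · aco m P' R T` has the closed form used by the core system (`…SplitGeneralCore`).

WHAT THIS IS NOT: nothing on crux stmt-ValiantsHypothesis-14610 or on `VP` versus `VNP`.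
-/

set_option linter.dupNamespace false

namespace Summit.ValiantsHypothesis.ValiantsHypothesis.Theorems.BarrierLever.AnchoredPeeling

namespace SplitGeneral

open Finset DecFamily

/-! ## 1. Row coordinates -/

/-- The row with `a`-index set `S`, `α`-bit `e`, `b`-index set `T` (by value). -/
def rowC (m : ℕ) (S : Finset ℕ) (e : Bool) (T : Finset ℕ) : Finset ℕ := S ∪ (if e then {m + 1} else ∅) ∪ sh m T

/-- Membership in `rowC`. -/
theorem mem_rowC {m : ℕ} {S T : Finset ℕ} {e : Bool} {v : ℕ} :
    v ∈ rowC m S e T ↔ v ∈ S ∨ (e = true ∧ v = m + 1) ∨ v ∈ sh m T := by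
  unfold rowC
  rw [Finset.mem_union, Finset.mem_union]
  have : (v ∈ (if e then ({m + 1} : Finset ℕ) else ∅)) ↔ (e = true ∧ v = m + 1) := by
    cases e <;> simp
  rw [this]; tauto

section Adm

variable {m : ℕ}

/-- The `a`-part of a row. -/
theorem filter_le_rowC {S T : Finset ℕ} (hS : S ⊆ range (m + 1)) (e : Bool) :
    (rowC m S e T).filter (fun v => v ≤ m) = S := by
  ext v
  rw [Finset.mem_filter, mem_rowC]
  constructor
  · rintro ⟨h | ⟨_, h⟩ | h, hv⟩
    · exact h
    · omega
    · have := le_of_mem_sh h; omega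
  · intro hv
    have := Finset.mem_range.mp (hS hv)
    exact ⟨Or.inl hv, by omega⟩

/-- The `α`-bit of a row. -/
theorem succ_mem_rowC_iff {S T : Finset ℕ} (hS : S ⊆ range (m + 1)) (e : Bool) : m + 1 ∈ rowC m S e T ↔ e = true := by
  rw [mem_rowC]
  constructor
  · rintro (h | ⟨he, _⟩ | h)
    · have := Finset.mem_range.mp (hS h); omega
    · exact he
    · have := le_of_mem_sh h; omega
  · intro he; exact Or.inr (Or.inl ⟨he, rfl⟩)

/-- The `b`-part of a row. -/
theorem filter_ge_rowC {S T : Finset ℕ} (hS : S ⊆ range (m + 1)) (e : Bool) :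
    (rowC m S e T).filter (fun v => m + 2 ≤ v) = sh m T := by
  ext v
  rw [Finset.mem_filter, mem_rowC]
  constructor
  · rintro ⟨h | ⟨_, h⟩ | h, hv⟩
    · have := Finset.mem_range.mp (hS h); omega
    · omega
    · exact h
  · intro hv; exact ⟨Or.inr (Or.inr hv), le_of_mem_sh hv⟩

/-- **`rowC` is injective on admissible triples.** -/
theorem rowC_inj {S S' T T' : Finset ℕ} {e e' : Bool} (hS : S ⊆ range (m + 1)) (hS' : S' ⊆ range (m + 1))
    (heq : rowC m S e T = rowC m S' e' T') : S = S' ∧ e = e' ∧ T = T' := by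
  refine ⟨?_, ?_, ?_⟩
  · rw [← filter_le_rowC hS e (T := T), heq, filter_le_rowC hS' e']
  · have h1 := succ_mem_rowC_iff hS e (T := T)
    rw [heq, succ_mem_rowC_iff hS' e' (T := T')] at h1
    cases e <;> cases e' <;> simp_all
  · apply sh_injective m
    rw [← filter_ge_rowC hS e (T := T), heq, filter_ge_rowC hS' e']

/-- Rows are faces of the `(2m+2)`-cube. -/
theorem rowC_subset_range {S T : Finset ℕ} (hS : S ⊆ range (m + 1)) (hT : T ⊆ range m) (e : Bool) :
    rowC m S e T ⊆ range (2 * m + 2) := by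
  intro v hv
  rw [Finset.mem_range]
  rcases mem_rowC.mp hv with h | ⟨_, h⟩ | h
  · have := Finset.mem_range.mp (hS h); omega
  · omega
  · obtain ⟨hle, hmem⟩ := mem_sh.mp h
    have := Finset.mem_range.mp (hT hmem); omega

/-- Union of rows. -/
theorem rowC_union (S S' T T' : Finset ℕ) (e e' : Bool) :
    rowC m S e T ∪ rowC m S' e' T' = rowC m (S ∪ S') (e || e') (T ∪ T') := by
  ext v
  simp only [Finset.mem_union, mem_rowC, sh, Finset.map_union, Bool.or_eq_true]
  tauto

/-- Disjointness of rows. -/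
theorem disjoint_rowC_iff {S S' T T' : Finset ℕ} {e e' : Bool} (hS : S ⊆ range (m + 1)) (hS' : S' ⊆ range (m + 1)) :
    Disjoint (rowC m S e T) (rowC m S' e' T') ↔ Disjoint S S' ∧ (e && e') = false ∧ Disjoint T T' := by
  constructor
  · intro hd
    refine ⟨?_, ?_, ?_⟩
    · rw [← filter_le_rowC hS e (T := T), ← filter_le_rowC hS' e' (T := T')]
      exact Finset.disjoint_filter_filter hd
    · cases he : e <;> cases he' : e' <;> simp only [Bool.and_self, Bool.and_false, Bool.false_and]
      subst he; subst he'
      exact absurd ((succ_mem_rowC_iff hS' true (T := T')).mpr rfl)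
        (Finset.disjoint_left.mp hd ((succ_mem_rowC_iff hS true (T := T)).mpr rfl))
    · have h := Finset.disjoint_filter_filter (p := fun v => m + 2 ≤ v) (q := fun v => m + 2 ≤ v) hd
      rw [filter_ge_rowC hS, filter_ge_rowC hS'] at h
      exact (Finset.disjoint_map _).mp h
  · rintro ⟨hdS, hde, hdT⟩
    rw [Finset.disjoint_left]
    intro v hv hv'
    rcases mem_rowC.mp hv with h | ⟨he, h⟩ | h <;> rcases mem_rowC.mp hv' with h' | ⟨he', h'⟩ | h'
    · exact Finset.disjoint_left.mp hdS h h'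
    · have := Finset.mem_range.mp (hS h); omega
    · have := Finset.mem_range.mp (hS h); have := le_of_mem_sh h'; omega
    · have := Finset.mem_range.mp (hS' h'); omega
    · rw [he, he'] at hde; exact Bool.noConfusion hde
    · have := le_of_mem_sh h'; omega
    · have := Finset.mem_range.mp (hS' h'); have := le_of_mem_sh h; omega
    · have := le_of_mem_sh h; omega
    · exact Finset.disjoint_left.mp ((Finset.disjoint_map _).mpr hdT) h h'

/-- **Convolution of two row deltas at a row.** -/
theorem conv_dlt_rowC {S₁ S₂ S T₁ T₂ T : Finset ℕ} {e₁ e₂ e : Bool} (h₁ : S₁ ⊆ range (m + 1)) (h₂ : S₂ ⊆ range (m + 1))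
    (hS : S ⊆ range (m + 1)) :
    conv (dlt (rowC m S₁ e₁ T₁)) (dlt (rowC m S₂ e₂ T₂)) (rowC m S e T) =
      (if (Disjoint S₁ S₂ ∧ (e₁ && e₂) = false ∧ Disjoint T₁ T₂) ∧ S = S₁ ∪ S₂ ∧ e = (e₁ || e₂) ∧ T = T₁ ∪ T₂ then (1 : ℂ) else 0) := by
  rw [conv_dlt_dlt]
  by_cases hc : (Disjoint S₁ S₂ ∧ (e₁ && e₂) = false ∧ Disjoint T₁ T₂) ∧ S = S₁ ∪ S₂ ∧ e = (e₁ || e₂) ∧ T = T₁ ∪ T₂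
  · rw [if_pos hc, if_pos ⟨(disjoint_rowC_iff h₁ h₂).mpr hc.1, by rw [rowC_union, hc.2.1, hc.2.2.1, hc.2.2.2]⟩]
  · rw [if_neg hc, if_neg]
    rintro ⟨hd, heq⟩
    exact hc ⟨(disjoint_rowC_iff h₁ h₂).mp hd, rowC_inj hS (Finset.union_subset h₁ h₂) (heq.trans (rowC_union _ _ _ _ _ _))⟩

/-- A row delta at a row. -/
theorem dlt_rowC {S₁ S T₁ T : Finset ℕ} {e₁ e : Bool} (h₁ : S₁ ⊆ range (m + 1)) (hS : S ⊆ range (m + 1)) :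
    (dlt (rowC m S₁ e₁ T₁) (rowC m S e T) : ℂ) = if S = S₁ ∧ e = e₁ ∧ T = T₁ then 1 else 0 := by
  unfold dlt
  by_cases hc : S = S₁ ∧ e = e₁ ∧ T = T₁
  · rw [if_pos hc, if_pos (by rw [hc.1, hc.2.1, hc.2.2])]
  · rw [if_neg hc, if_neg (fun heq => hc (rowC_inj hS h₁ heq))]

/-! ## 2. The limit design in row coordinates -/

/-- Named shapes: a persona face. -/
theorem rowC_persona (P : Finset ℕ) : rowC m P false ∅ = P := by
  ext v; rw [mem_rowC]; simp [sh]

/-- Named shapes: `{α} ∪ sh s`. -/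
theorem rowC_alpha (s : Finset ℕ) : rowC m ∅ true s = insert (m + 1) (sh m s) := by
  ext v; rw [mem_rowC, Finset.mem_insert]; simp

/-- Named shapes: `{m, α} ∪ sh s`. -/
theorem rowC_alpha_top (s : Finset ℕ) : rowC m {m} true s = insert m (insert (m + 1) (sh m s)) := by
  ext v; rw [mem_rowC, Finset.mem_insert, Finset.mem_insert, Finset.mem_singleton]; simp

/-- Named shapes: an independent face `sh t`. -/
theorem rowC_indep (t : Finset ℕ) : rowC m ∅ false t = sh m t := by
  ext v; rw [mem_rowC]; simp

/-- The fat indicator of `v_{m}` in row coordinates: `[α ∈ C ∧ C ∖ α ⊆ sh (range m)] = [S = ∅ ∧ e]`. -/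
theorem fat_rowC {S T : Finset ℕ} {e : Bool} (hS : S ⊆ range (m + 1)) (hT : T ⊆ range m) :
    (m + 1 ∈ rowC m S e T ∧ (rowC m S e T).erase (m + 1) ⊆ sh m (range m)) ↔ (S = ∅ ∧ e = true) := by
  rw [succ_mem_rowC_iff hS]
  constructor
  · rintro ⟨he, hsub⟩
    refine ⟨Finset.eq_empty_of_forall_notMem (fun v hv => ?_), he⟩
    have hvm := Finset.mem_range.mp (hS hv)
    have : v ∈ (rowC m S e T).erase (m + 1) := Finset.mem_erase.mpr ⟨by omega, mem_rowC.mpr (Or.inl hv)⟩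
    have := le_of_mem_sh (hsub this); omega
  · rintro ⟨rfl, he⟩
    refine ⟨he, fun v hv => ?_⟩
    obtain ⟨hv1, hv⟩ := Finset.mem_erase.mp hv
    rcases mem_rowC.mp hv with h | ⟨_, h⟩ | h
    · exact absurd h (Finset.notMem_empty v)
    · exact absurd h hv1
    · exact (sh_subset_sh_iff T (range m)).mpr hT h

/-- The `α`-part coefficient function of the clique vertex `P` at the row `(S, true, T)` (memo §2.2: `c_P g_P(S) m_P(T)`). -/
noncomputable def aco (m : ℕ) (P S T : Finset ℕ) : ℂ :=
  if P = ∅ then ind (S = ∅ ∧ T = ∅)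
  else if P = {m} then ind (S = ∅)
  else (cw m P : ℂ) * (ind (S = ∅ ∧ T = P.erase m) + ind (m ∉ P ∧ S = {m} ∧ T = P.erase m))

/-- Codes of clique vertices are `< 2^{m+1}` and decode to their index set. -/
theorem enc_lt_of_subset {P : Finset ℕ} (hP : P ⊆ range (m + 1)) : enc P < 2 ^ (m + 1) := enc_lt_two_pow hP

/-- Recognising a persona face among rows. -/
theorem rowC_eq_persona_iff {P S T : Finset ℕ} {e : Bool} (hP : P ⊆ range (m + 1)) (hS : S ⊆ range (m + 1)) :
    rowC m S e T = P ↔ S = P ∧ e = false ∧ T = ∅ :=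
  ⟨fun h => rowC_inj hS hP (h.trans (rowC_persona P).symm), fun h => by rw [h.1, h.2.1, h.2.2, rowC_persona]⟩

/-- Recognising `{α} ∪ sh s` among rows. -/
theorem rowC_eq_alpha_iff {s S T : Finset ℕ} {e : Bool} (hS : S ⊆ range (m + 1)) :
    rowC m S e T = insert (m + 1) (sh m s) ↔ S = ∅ ∧ e = true ∧ T = s := by
  rw [← rowC_alpha (m := m) s]
  exact ⟨fun h => rowC_inj hS (Finset.empty_subset _) h, fun h => by rw [h.1, h.2.1, h.2.2]⟩

/-- Recognising `{m, α} ∪ sh s` among rows. -/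
theorem rowC_eq_alpha_top_iff {s S T : Finset ℕ} {e : Bool} (hS : S ⊆ range (m + 1)) :
    rowC m S e T = insert m (insert (m + 1) (sh m s)) ↔ S = {m} ∧ e = true ∧ T = s := by
  rw [← rowC_alpha_top (m := m) s]
  exact ⟨fun h => rowC_inj hS (Finset.singleton_subset_iff.mpr (Finset.mem_range.mpr (Nat.lt_succ_self m))) h,
    fun h => by rw [h.1, h.2.1, h.2.2]⟩

/-- Recognising `{α}` among rows. -/
theorem rowC_eq_alpha_empty_iff {S T : Finset ℕ} {e : Bool} (hS : S ⊆ range (m + 1)) :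
    rowC m S e T = {m + 1} ↔ S = ∅ ∧ e = true ∧ T = ∅ := by
  have : ({m + 1} : Finset ℕ) = insert (m + 1) (sh m ∅) := by simp [sh]
  rw [this, rowC_eq_alpha_iff hS]

/-- Recognising `{m}` among rows. -/
theorem rowC_eq_top_iff {S T : Finset ℕ} {e : Bool} (hS : S ⊆ range (m + 1)) :
    rowC m S e T = {m} ↔ S = {m} ∧ e = false ∧ T = ∅ :=
  rowC_eq_persona_iff (Finset.singleton_subset_iff.mpr (Finset.mem_range.mpr (Nat.lt_succ_self m))) hS

/-- **The clique vertex `v_P` at a row**: persona + `[e] · aco`. -/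
theorem vtopN_clique_rowC {P S T : Finset ℕ} {e : Bool} (hP : P ⊆ range (m + 1)) (hS : S ⊆ range (m + 1)) (hT : T ⊆ range m) :
    vtopN m (enc P) (rowC m S e T) = ind (P ≠ ∅ ∧ S = P ∧ e = false ∧ T = ∅) + ind (e = true) * aco m P S T := by
  classical
  have hy := enc_lt_of_subset hP
  unfold vtopN aco ind
  rw [if_pos hy, bits_enc]
  by_cases hP0 : P = ∅
  · subst hP0
    simp only [if_true, rowC_eq_alpha_empty_iff hS, ne_eq, not_true_eq_false, false_and, if_false, zero_add]
    cases e <;> simp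
  · rw [if_neg hP0, if_neg hP0]
    by_cases hPm : P = {m}
    · subst hPm
      simp only [if_true, rowC_eq_top_iff hS, fat_rowC hS hT]
      cases e <;> simp [Finset.singleton_ne_empty]
    · rw [if_neg hPm, if_neg hPm]
      simp only [rowC_eq_persona_iff hP hS, rowC_eq_alpha_iff hS, rowC_eq_alpha_top_iff hS]
      cases e <;> simp [hP0]

/-- The code of the independent vertex `u_t`. -/
def yu (m : ℕ) (t : Finset ℕ) : ℕ := 2 ^ (m + 1) + enc t - 1

/-- Arithmetic of independent codes. -/
theorem yu_spec {t : Finset ℕ} (ht : t ∈ smallSets m) :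
    ¬ yu m t < 2 ^ (m + 1) ∧ yu m t + 1 < 2 ^ (m + 1) + 2 ^ m ∧ bits (yu m t + 1 - 2 ^ (m + 1)) = t := by
  obtain ⟨htr, ht0⟩ := mem_smallSets.mp ht
  have h1 : enc t < 2 ^ m := enc_lt_two_pow htr
  have h2 : enc t ≠ 0 := fun h => ht0 (enc_eq_zero_iff.mp h)
  unfold yu
  refine ⟨by omega, by omega, ?_⟩
  have : 2 ^ (m + 1) + enc t - 1 + 1 - 2 ^ (m + 1) = enc t := by omega
  rw [this, bits_enc]

/-- **The independent vertex `u_t` at a row.** -/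
theorem vtopN_indep_rowC {t S T : Finset ℕ} {e : Bool} (ht : t ∈ smallSets m) (hS : S ⊆ range (m + 1)) :
    vtopN m (yu m t) (rowC m S e T) = ind (S = ∅ ∧ e = false ∧ T = t) := by
  obtain ⟨h1, h2, h3⟩ := yu_spec ht
  unfold vtopN
  rw [if_neg h1, if_pos h2, h3, ← rowC_indep, ind, ind, ← dlt, dlt_rowC (Finset.empty_subset _) hS]


end Adm

end SplitGeneral

end Summit.ValiantsHypothesis.ValiantsHypothesis.Theorems.BarrierLever.AnchoredPeeling
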